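import Mathlib
import HarnessLib
import Summits.HubbardSuperconductivity.HubbardSuperconductivity.Theorems.KLProgrammeKLRegimeEnginePairTransferRelResIdxResolvedAll
import Summits.HubbardSuperconductivity.HubbardSuperconductivity.Theorems.KLProgrammeKLRegimeEnginePairTransferRelResAnalyticResolved

/-!
# Route `KLProgramme` — ENGINE child gen 8 (stmt-HubbardSuperconductivity-20437 `KLRegimeEngineV17F2`), class #5 rev 3 — THE ALL-Qm SPINE (cell STATUS (R247), regime (β) producer of record):
# the ANALYTIC keyed step over the resolved door, GUARD-GENERIC — `pairTransferRelResIdx_family_succ_of_analytic_resolved_all`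
# (cell gate-hubbard-kl, seat hubbard-kl-k3c1-p1 g16; CLASS5-RESOLVED-STEP.md §14 / KLTC-INDEX v12 §S)

WHY.  Row 59 (`pairTransferRelResIdx_family_succ_of_analytic_resolved`) with the pair-class guard replaced by an arbitrary antitone predicate `C L Qm n`; over row 58b-all.
Guard-generic plumbing over landed doors (token move `IsPairClassAt L Qm ↦ C L Qm`, `C` any ANTITONE guard; the all-Qm family is `C := fun _ _ _ => True`, the in-class family
`C := fun L Qm n => IsPairClassAt L Qm n`); nothing about the model's sizes is asserted; nothing asserts (X).3, (c), K3 or superconductivity.  0 kit · 0 lit.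
-/

noncomputable section

namespace Summit.HubbardSuperconductivity.HubbardSuperconductivity.Theorems.KLRegimeSplit

set_option linter.dupNamespace false -- summit = problem name (single-conjunct summit), D-0017

open Finset Matrix Set Literature.MathematicalPhysics.QuantumLattice Literature.Probability.LatticeModels GrassmannAlgebra
open Literature.MathematicalPhysics.QuantumLattice.FermiRG
open Summit.HubbardSuperconductivity.HubbardSuperconductivity.Theorems.KLProgrammeCooperResummation
open Summit.HubbardSuperconductivity.HubbardSuperconductivity.Theorems.KLProgrammeLegKernels
open Summit.HubbardSuperconductivity.HubbardSuperconductivity.Theorems.DispersionFlow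
open Summit.HubbardSuperconductivity.HubbardSuperconductivity.Theorems.KLRegimeWick
open Summit.HubbardSuperconductivity.HubbardSuperconductivity.Theorems.EngineV8

section AnalyticResolvedAll

variable (L M : ℕ) [NeZero L] [NeZero M]

set_option maxHeartbeats 3200000 in -- very long hypothesis bundle; plumbing into `pairTransferRelResIdx_family_succ_resolved` (same budget as row 24)
/-- **`pairTransferRelResIdx_family_succ_of_analytic_resolved_all`** (guard-generic twin of `pairTransferRelResIdx_family_succ_of_analytic_resolved`, p637387) — the private relative-residue family at the bars `RB n j j′ := θ·transferBarRelIdx L G P r β U n j′`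
(`0 ≤ θ`), `n → n+1`, from the ANALYTIC sizes only, over the RESOLVED door (module docstring).  The member curves `A A′ b b′ a` are pinned by their defining
equations (pass `rfl`), as are the rung profiles `ρ j Qm := klRungProfile … n s_{n+1,j} Qm` and the history relative weights `ah`. -/
theorem pairTransferRelResIdx_family_succ_of_analytic_resolved_all (C : ∀ L : ℕ, TorusSite 2 L → ℕ → Prop) (hC : ∀ (L : ℕ) (Qm : TorusSite 2 L) (j n : ℕ), j ≤ n → C L Qm n → C L Qm j)
    {R : RenConsts} {N : ℕ} {G : GeoConsts} (hCF : 0 ≤ G.CF) {P : SplitConsts} (hKl : 0 ≤ P.Klam) {r : ℝ} (hr : 0 ≤ r)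
    {β U μ : ℝ} {n : ℕ} {mA θ : ℝ} (hm : 0 ≤ mA) (hθ0 : 0 ≤ θ)
    (hKf : FrameOK R U N μ (klFlowFrameU L M β U μ (n + 1))) (hβ : klBetaMin ≤ β) (hβL : β ≤ L) (hη₀ : Real.pi / (L : ℝ) ≤ klScale klE0 n)
    (hnum : mA * ((2 : ℝ) ^ 10 * 15367) ≤ 1 / 3)
    (hZ : ∀ Λ ∈ Icc (klScale klE0 (n + 1)) (klScale klE0 n), hubbardEffPartitionFnCT L M β U μ 0 (klFlowFrameU L M β U μ (n + 1)) Λ ≠ 0)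
    (A A' : ℕ → TorusSite 2 L → ℝ → Matrix (TorusSite 2 L) (TorusSite 2 L) ℂ) (b b' : ℕ → TorusSite 2 L → ℝ → TorusSite 2 L → ℂ)
    (a : ℕ → ℕ → TorusSite 2 L → ℝ → TorusSite 2 L → ℂ)
    (hAdef : A = fun j Qm t => Matrix.of fun k k' : TorusSite 2 L => if k ∈ klBall L μ 0 ∧ k' ∈ klBall L μ 0 then
      vertexFn L M β (gaussConv ℂ
        (softCovOf L M β μ (klFlowFrameU L M β U μ (n + 1)) (softSymbolCompl L M β μ (klFlowFrameU L M β U μ (n + 1)) (n + 1) j) + hubbardCovAboveCT L M β μ 0 (klFlowFrameU L M β U μ (n + 1)) (klScale klE0 (n + 1)) -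
          hubbardCovAboveCT L M β μ 0 (klFlowFrameU L M β U μ (n + 1)) (klScale klE0 n + t * (klScale klE0 (n + 1) - klScale klE0 n)))
        (hubbardEffectiveActionCT L M β U μ 0 (klFlowFrameU L M β U μ (n + 1)) (klScale klE0 n + t * (klScale klE0 (n + 1) - klScale klE0 n)))) 4
        ![(((omega0 M, k'), 0), 0), ((((omega0 M).rev, Qm - k'), 1), 0), ((((omega0 M).rev, Qm - k), 1), 1), (((omega0 M, k), 0), 1)]
      else 0)
    (hA'def : A' = fun j Qm t => Matrix.of fun k k' : TorusSite 2 L => if k ∈ klBall L μ 0 ∧ k' ∈ klBall L μ 0 then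
      (klScale klE0 (n + 1) - klScale klE0 n) • -((2 : ℂ)⁻¹ * vertexFn L M β (gaussConv ℂ
        (softCovOf L M β μ (klFlowFrameU L M β U μ (n + 1)) (softSymbolCompl L M β μ (klFlowFrameU L M β U μ (n + 1)) (n + 1) j) + hubbardCovAboveCT L M β μ 0 (klFlowFrameU L M β U μ (n + 1)) (klScale klE0 (n + 1)) -
          hubbardCovAboveCT L M β μ 0 (klFlowFrameU L M β U μ (n + 1)) (klScale klE0 n + t * (klScale klE0 (n + 1) - klScale klE0 n)))
        (grassmannDerivPairing ℂ
          (Matrix.of fun X Y : HubbardFieldIdx L M => deriv (fun Λ'' : ℝ => hubbardCovAboveCT L M β μ 0 (klFlowFrameU L M β U μ (n + 1)) Λ'' X Y)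
            (klScale klE0 n + t * (klScale klE0 (n + 1) - klScale klE0 n)))
          (hubbardEffectiveActionCT L M β U μ 0 (klFlowFrameU L M β U μ (n + 1)) (klScale klE0 n + t * (klScale klE0 (n + 1) - klScale klE0 n)))
          (hubbardEffectiveActionCT L M β U μ 0 (klFlowFrameU L M β U μ (n + 1)) (klScale klE0 n + t * (klScale klE0 (n + 1) - klScale klE0 n))))) 4
        ![(((omega0 M, k'), 0), 0), ((((omega0 M).rev, Qm - k'), 1), 0), ((((omega0 M).rev, Qm - k), 1), 1), (((omega0 M, k), 0), 1)])
      else 0)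
    (hbdef : b = fun j Qm t p => -((klBubbleMass L M β μ (klFlowFrameU L M β U μ (n + 1))
        (fun k => (softSymbolCompl L M β μ (klFlowFrameU L M β U μ (n + 1)) (n + 1) j) k + (hubbardCutoffWeightCT L M β μ (klFlowFrameU L M β U μ (n + 1)) (klScale klE0 (n + 1)) k -
          hubbardCutoffWeightCT L M β μ (klFlowFrameU L M β U μ (n + 1)) (klScale klE0 n + t * (klScale klE0 (n + 1) - klScale klE0 n)) k))
        (fun k => (softSymbolCompl L M β μ (klFlowFrameU L M β U μ (n + 1)) (n + 1) j) k + (hubbardCutoffWeightCT L M β μ (klFlowFrameU L M β U μ (n + 1)) (klScale klE0 (n + 1)) k -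
          hubbardCutoffWeightCT L M β μ (klFlowFrameU L M β U μ (n + 1)) (klScale klE0 n + t * (klScale klE0 (n + 1) - klScale klE0 n)) k)) Qm p : ℝ) : ℂ))
    (hb'def : b' = fun j Qm t p => (((klScale klE0 (n + 1) - klScale klE0 n) *
        (klBubbleMass L M β μ (klFlowFrameU L M β U μ (n + 1))
            (fun k => deriv (fun Λ' => hubbardCutoffWeightCT L M β μ (klFlowFrameU L M β U μ (n + 1)) Λ' k) (klScale klE0 n + t * (klScale klE0 (n + 1) - klScale klE0 n)))
            (fun k => (softSymbolCompl L M β μ (klFlowFrameU L M β U μ (n + 1)) (n + 1) j) k + (hubbardCutoffWeightCT L M β μ (klFlowFrameU L M β U μ (n + 1)) (klScale klE0 (n + 1)) k -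
          hubbardCutoffWeightCT L M β μ (klFlowFrameU L M β U μ (n + 1)) (klScale klE0 n + t * (klScale klE0 (n + 1) - klScale klE0 n)) k)) Qm p +
          klBubbleMass L M β μ (klFlowFrameU L M β U μ (n + 1))
            (fun k => (softSymbolCompl L M β μ (klFlowFrameU L M β U μ (n + 1)) (n + 1) j) k + (hubbardCutoffWeightCT L M β μ (klFlowFrameU L M β U μ (n + 1)) (klScale klE0 (n + 1)) k -
          hubbardCutoffWeightCT L M β μ (klFlowFrameU L M β U μ (n + 1)) (klScale klE0 n + t * (klScale klE0 (n + 1) - klScale klE0 n)) k))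
            (fun k => deriv (fun Λ' => hubbardCutoffWeightCT L M β μ (klFlowFrameU L M β U μ (n + 1)) Λ' k) (klScale klE0 n + t * (klScale klE0 (n + 1) - klScale klE0 n)))
            Qm p) : ℝ) : ℂ))
    (hadef : a = fun j j' Qm t p => (b j Qm t p - b j' Qm t p) +
      (-(((klTransferWeight L M β μ (klFlowFrameU L M β U μ (n + 1)) (n + 1) (softSymbolCompl L M β μ (klFlowFrameU L M β U μ (n + 1)) (n + 1) j) Qm p -
          klTransferWeight L M β μ (klFlowFrameU L M β U μ (n + 1)) (n + 1) (softSymbolCompl L M β μ (klFlowFrameU L M β U μ (n + 1)) (n + 1) j') Qm p : ℝ)) : ℂ) -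
        (b j Qm 1 p - b j' Qm 1 p)))
    (ρ : ℕ → TorusSite 2 L → TorusSite 2 L → ℝ)
    (hρdef : ρ = fun j Qm c => klRungProfile L M β μ (klFlowFrameU L M β U μ (n + 1)) n (softSymbolCompl L M β μ (klFlowFrameU L M β U μ (n + 1)) (n + 1) j) Qm c)
    (ah : ℕ → ℕ → TorusSite 2 L → TorusSite 2 L → ℂ)
    (hahdef : ah = fun j j' Qm c => -(((klTransferWeight L M β μ (klFlowFrameU L M β U μ n) n (softSymbolCompl L M β μ (klFlowFrameU L M β U μ n) n j) Qm c -
            klTransferWeight L M β μ (klFlowFrameU L M β U μ n) n (softSymbolCompl L M β μ (klFlowFrameU L M β U μ n) n j') Qm c : ℝ)) : ℂ))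
    (hhist : ∀ j j' : ℕ, n ≤ j' → j' ≤ j → j ≤ nScales β + 1 → ∀ Qm : TorusSite 2 L, C L Qm n →
      ∀ k ∈ klBall L μ 0, ∀ k' ∈ klBall L μ 0,
      ‖(klMemberArrayF L M β U μ n (softSymbolCompl L M β μ (klFlowFrameU L M β U μ n) n j) Qm + klMemberArrayF L M β U μ n (softSymbolCompl L M β μ (klFlowFrameU L M β U μ n) n j) Qm *
          diagonal (fun c => -(((klTransferWeight L M β μ (klFlowFrameU L M β U μ n) n (softSymbolCompl L M β μ (klFlowFrameU L M β U μ n) n j) Qm c -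
            klTransferWeight L M β μ (klFlowFrameU L M β U μ n) n (softSymbolCompl L M β μ (klFlowFrameU L M β U μ n) n j') Qm c : ℝ)) : ℂ)) * klMemberArrayF L M β U μ n (softSymbolCompl L M β μ (klFlowFrameU L M β U μ n) n j') Qm -
          klMemberArrayF L M β U μ n (softSymbolCompl L M β μ (klFlowFrameU L M β U μ n) n j') Qm) k k'‖ ≤ θ * transferBarRelIdx L G P r β U n j' Qm k k')
    (hdata : ∀ j j' : ℕ, n + 1 ≤ j' → j' ≤ j → j ≤ nScales β + 1 → ∀ Qm : TorusSite 2 L, C L Qm (n + 1) →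
      ∃ (ηr η₁ η₂ R₀ I Ran : TorusSite 2 L → TorusSite 2 L → ℝ) (d : TorusSite 2 L → ℝ),
        -- ANALYTIC: a priori size of the two member arrays along the slice
        (∀ t ∈ Icc (0 : ℝ) 1, ∀ x y, ‖A j Qm t x y‖ ≤ mA) ∧ (∀ t ∈ Icc (0 : ℝ) 1, ∀ x y, ‖A j' Qm t x y‖ ≤ mA) ∧
        -- the history array's a priori size; the START RE-FRAME majorants ((F)(i) lane) against the history objects at frame `K_n`
        (∀ x y, ‖klMemberArrayF L M β U μ n (softSymbolCompl L M β μ (klFlowFrameU L M β U μ n) n j) Qm x y‖ ≤ mA) ∧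
        (∀ x y, ‖((A j Qm 0 - klMemberArrayF L M β U μ n (softSymbolCompl L M β μ (klFlowFrameU L M β U μ n) n j) Qm) - (A j' Qm 0 - klMemberArrayF L M β U μ n (softSymbolCompl L M β μ (klFlowFrameU L M β U μ n) n j') Qm)) x y‖ ≤ ηr x y) ∧
        (∀ x y, ‖(A j Qm 0 - klMemberArrayF L M β U μ n (softSymbolCompl L M β μ (klFlowFrameU L M β U μ n) n j) Qm) x y‖ ≤ η₁ x y) ∧
        (∀ x y, ‖(A j' Qm 0 - klMemberArrayF L M β U μ n (softSymbolCompl L M β μ (klFlowFrameU L M β U μ n) n j') Qm) x y‖ ≤ η₂ x y) ∧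
        (∀ c, ‖a j j' Qm 0 c - ah j j' Qm c‖ ≤ d c) ∧
        (∀ x y, (ηr x y + mA * ∑ c, η₁ x c * (d c + ‖ah j j' Qm c‖) + mA * mA * ∑ c, d c + mA * ∑ c, ‖ah j j' Qm c‖ * η₂ c y) ≤ R₀ x y) ∧
        -- ANALYTIC: the RESOLVED slice integral of the relative Riccati defect (member defects only convolved against the relative weight, `kltc_relSource_resolved_le`)
        (∀ x y, (∫ t in (0 : ℝ)..1, ‖(((A' j Qm t + A j Qm t * diagonal (b' j Qm t) * A j Qm t) * (1 + diagonal (a j j' Qm t) * A j' Qm t) +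
            A j Qm t * diagonal (a j j' Qm t) * (A' j' Qm t + A j' Qm t * diagonal (b' j' Qm t) * A j' Qm t) - (A' j' Qm t + A j' Qm t * diagonal (b' j' Qm t) * A j' Qm t))) x y‖) ≤ I x y) ∧
        -- the ANALYTIC majorant `Ran` = re-frame part + resolved source integral (NO sups, NO Gronwall product, NO inherited flat bar)
        (∀ x y, R₀ x y + I x y ≤ Ran x y) ∧
        -- ITS budget: the four-term FT form of `Ran` against the frame slack of the inherited bar plus three fifths of the slice's ROOM
        (∀ k ∈ klBall L μ 0, ∀ k' ∈ klBall L μ 0,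
          Ran k k' + ∑ c, Ran k c * ρ j' Qm c * (3 / 2 * mA) + ∑ a', 3 / 2 * mA * ρ j Qm a' * Ran a' k' +
              ∑ a', ∑ c, 3 / 2 * mA * ρ j Qm a' * Ran a' c * ρ j' Qm c * (3 / 2 * mA) ≤
            θ * (((2 : ℝ) ^ (n + 2))⁻¹ * transferBarRelIdx L G P r β U n j' Qm k k' + 3 / 5 *
              (klIdxPrefactor r (n + 1) * ((P.Klam * U) ^ 2 *
              ((min (klTorusNorm L (k - k') / klScale klE0 (n + 1)) (klScale klE0 (n + 1) / klTorusNorm L (k - k')) +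
                  min (klTorusNorm L (k + k' - Qm) / klScale klE0 (n + 1)) (klScale klE0 (n + 1) / klTorusNorm L (k + k' - Qm)) +
                  ((2 : ℝ) ^ n)⁻¹ + 3 * ((L : ℝ))⁻¹) * klIdxMass n j' + ((4 : ℝ) ^ (n + 1))⁻¹ * klIdxOverlap (n + 1) j') +
            ((P.Klam * |U|) ^ 3 * ((2 : ℝ) ^ n)⁻¹ + 3 * thermalBar G P U β (n + 1)) * klIdxMass n j'))))) :
    ∀ j j' : ℕ, n + 1 ≤ j' → j' ≤ j → j ≤ nScales β + 1 → ∀ Qm : TorusSite 2 L, C L Qm (n + 1) →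
      ∀ k ∈ klBall L μ 0, ∀ k' ∈ klBall L μ 0,
      ‖(klMemberArrayF L M β U μ (n + 1) (softSymbolCompl L M β μ (klFlowFrameU L M β U μ (n + 1)) (n + 1) j) Qm + klMemberArrayF L M β U μ (n + 1) (softSymbolCompl L M β μ (klFlowFrameU L M β U μ (n + 1)) (n + 1) j) Qm *
          diagonal (fun p => -(((klTransferWeight L M β μ (klFlowFrameU L M β U μ (n + 1)) (n + 1) (softSymbolCompl L M β μ (klFlowFrameU L M β U μ (n + 1)) (n + 1) j) Qm p -
            klTransferWeight L M β μ (klFlowFrameU L M β U μ (n + 1)) (n + 1) (softSymbolCompl L M β μ (klFlowFrameU L M β U μ (n + 1)) (n + 1) j') Qm p : ℝ)) : ℂ)) * klMemberArrayF L M β U μ (n + 1) (softSymbolCompl L M β μ (klFlowFrameU L M β U μ (n + 1)) (n + 1) j') Qm -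
          klMemberArrayF L M β U μ (n + 1) (softSymbolCompl L M β μ (klFlowFrameU L M β U μ (n + 1)) (n + 1) j') Qm) k k'‖ ≤ θ * transferBarRelIdx L G P r β U (n + 1) j' Qm k k' := by
  -- numerics: the one numeral implies the step row of `klam_inheritedFT_le` and the smallness rows
  have h15 : ((2 : ℝ) ^ 10 * 15367) = 15735808 := by norm_num
  have hnum' : mA * 15735808 ≤ 1 / 3 := by rw [h15] at hnum; exact hnum
  have hstep : 3 / 2 * mA * 738288 ≤ 1 / 32 := by nlinarith
  have hβ0 : 0 < β := pos_of_klBetaMin_le hβ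
  subst hahdef
  refine pairTransferRelResIdx_family_succ_resolved_all L M C hC hm (RB := fun i j j' Qm k k' => θ * transferBarRelIdx L G P r β U i j' Qm k k') hZ
    A A' b b' a hAdef hA'def hbdef hb'def hadef hhist ?_
  intro j j' h1 h2 h3 Qm hQm
  obtain ⟨ηr, η₁, η₂, R₀, I, Ran, d, hA₁, hA₂, hH, hηr, hη₁, hη₂, hd, hR₀, hI, hRan, hbud⟩ := hdata j j' h1 h2 h3 Qm hQm
  beta_reduce at hd hR₀
  have hj1 : n + 1 ≤ j := h1.trans h2
  -- MODEL rows by name: admissibility of the two members, integrated rate profiles, profile masses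
  have hψ₁ : ∀ k, 0 ≤ softSymbolCompl L M β μ (klFlowFrameU L M β U μ (n + 1)) (n + 1) j k := fun k =>
    ((isSoftSymbol_compl (L := L) (M := M) β μ (klFlowFrameU L M β U μ (n + 1)) hj1).1 k).1
  have hψ₂ : ∀ k, 0 ≤ softSymbolCompl L M β μ (klFlowFrameU L M β U μ (n + 1)) (n + 1) j' k := fun k =>
    ((isSoftSymbol_compl (L := L) (M := M) β μ (klFlowFrameU L M β U μ (n + 1)) h1).1 k).1
  have hρ0 : ∀ i c, 0 ≤ ρ i Qm c := fun i c => by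
    rw [hρdef]; exact klRungProfile_nonneg β μ _ hβ0 n _ Qm c
  have hZρ : ∀ i, n + 1 ≤ i → ∑ c, ρ i Qm c ≤ 738288 := fun i hi => by
    rw [hρdef]; exact sum_klRungProfile_compl_le β μ _ hKf hβ hβL hi Qm
  have hη₁0 : ∀ x c, 0 ≤ η₁ x c := fun x c => (norm_nonneg _).trans (hη₁ x c)
  have ha0 : ∀ c, ‖a j j' Qm 0 c‖ ≤ d c + ‖(-(((klTransferWeight L M β μ (klFlowFrameU L M β U μ n) n (softSymbolCompl L M β μ (klFlowFrameU L M β U μ n) n j) Qm c -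
            klTransferWeight L M β μ (klFlowFrameU L M β U μ n) n (softSymbolCompl L M β μ (klFlowFrameU L M β U μ n) n j') Qm c : ℝ)) : ℂ))‖ := fun c => by
    have h := hd c
    calc ‖a j j' Qm 0 c‖ = ‖(a j j' Qm 0 c - (-(((klTransferWeight L M β μ (klFlowFrameU L M β U μ n) n (softSymbolCompl L M β μ (klFlowFrameU L M β U μ n) n j) Qm c -
            klTransferWeight L M β μ (klFlowFrameU L M β U μ n) n (softSymbolCompl L M β μ (klFlowFrameU L M β U μ n) n j') Qm c : ℝ)) : ℂ))) + (-(((klTransferWeight L M β μ (klFlowFrameU L M β U μ n) n (softSymbolCompl L M β μ (klFlowFrameU L M β U μ n) n j) Qm c -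
            klTransferWeight L M β μ (klFlowFrameU L M β U μ n) n (softSymbolCompl L M β μ (klFlowFrameU L M β U μ n) n j') Qm c : ℝ)) : ℂ))‖ := by rw [sub_add_cancel]
      _ ≤ ‖a j j' Qm 0 c - (-(((klTransferWeight L M β μ (klFlowFrameU L M β U μ n) n (softSymbolCompl L M β μ (klFlowFrameU L M β U μ n) n j) Qm c -
            klTransferWeight L M β μ (klFlowFrameU L M β U μ n) n (softSymbolCompl L M β μ (klFlowFrameU L M β U μ n) n j') Qm c : ℝ)) : ℂ))‖ + ‖(-(((klTransferWeight L M β μ (klFlowFrameU L M β U μ n) n (softSymbolCompl L M β μ (klFlowFrameU L M β U μ n) n j) Qm c -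
            klTransferWeight L M β μ (klFlowFrameU L M β U μ n) n (softSymbolCompl L M β μ (klFlowFrameU L M β U μ n) n j') Qm c : ℝ)) : ℂ))‖ := norm_add_le _ _
      _ ≤ d c + ‖(-(((klTransferWeight L M β μ (klFlowFrameU L M β U μ n) n (softSymbolCompl L M β μ (klFlowFrameU L M β U μ n) n j) Qm c -
            klTransferWeight L M β μ (klFlowFrameU L M β U μ n) n (softSymbolCompl L M β μ (klFlowFrameU L M β U μ n) n j') Qm c : ℝ)) : ℂ))‖ := by linarith
  -- the inherited bar on/off the ball
  have hTb0 : ∀ x y, 0 ≤ transferBarRelIdx L G P r β U n j' Qm x y := fun x y => transferBarRelIdx_nonneg hCF hKl hr β U n j' Qm x y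
  have hite : ∀ x y, (if x ∈ klBall L μ 0 ∧ y ∈ klBall L μ 0 then θ * transferBarRelIdx L G P r β U n j' Qm x y else 0) ≤
      θ * transferBarRelIdx L G P r β U n j' Qm x y := fun x y => by
    split_ifs
    · exact le_rfl
    · exact mul_nonneg hθ0 (hTb0 x y)
  refine ⟨ρ j Qm, ρ j' Qm, ηr, η₁, η₂,
    fun x y => (if x ∈ klBall L μ 0 ∧ y ∈ klBall L μ 0 then θ * transferBarRelIdx L G P r β U n j' Qm x y else 0) + R₀ x y, I,
    fun x y => (if x ∈ klBall L μ 0 ∧ y ∈ klBall L μ 0 then θ * transferBarRelIdx L G P r β U n j' Qm x y else 0) + Ran x y, d,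
    hA₁, hA₂, ?_, ?_, ?_, ?_, hH, hηr, hη₁, hη₂, hd, ?_, hI, ?_, ?_⟩
  · -- integrated rate profile of member `j` (row 57)
    intro c
    rw [hρdef]
    exact klmf_integral_norm_rate_le_klRungProfile β μ _ hβ0 n hψ₁ Qm c (fun t p => b' j Qm t p) (by rw [hb'def])
  · -- integrated rate profile of member `j′`
    intro c
    rw [hρdef]
    exact klmf_integral_norm_rate_le_klRungProfile β μ _ hβ0 n hψ₂ Qm c (fun t p => b' j' Qm t p) (by rw [hb'def])
  · -- `mA·Σρ₁ ≤ 1/3`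
    have := mul_le_mul_of_nonneg_left (hZρ j hj1) hm
    linarith
  · -- `mA·Σρ₂ ≤ 1/3`
    have := mul_le_mul_of_nonneg_left (hZρ j' h1) hm
    linarith
  · -- the start residue majorant `T₀`
    intro x y
    beta_reduce
    have hsum : ∑ c, η₁ x c * ‖a j j' Qm 0 c‖ ≤ ∑ c, η₁ x c * (d c + ‖(-(((klTransferWeight L M β μ (klFlowFrameU L M β U μ n) n (softSymbolCompl L M β μ (klFlowFrameU L M β U μ n) n j) Qm c -
            klTransferWeight L M β μ (klFlowFrameU L M β U μ n) n (softSymbolCompl L M β μ (klFlowFrameU L M β U μ n) n j') Qm c : ℝ)) : ℂ))‖) :=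
      Finset.sum_le_sum fun c _ => mul_le_mul_of_nonneg_left (ha0 c) (hη₁0 x c)
    have := mul_le_mul_of_nonneg_left hsum hm
    have hR := hR₀ x y
    linarith
  · -- the step majorant `S = T₀ + I`
    intro x y
    beta_reduce
    have hR := hRan x y
    linarith
  · -- the budget
    intro k hk k' hk'
    beta_reduce
    have hb := hbud k hk k' hk'
    have hSle : ∀ x y, (if x ∈ klBall L μ 0 ∧ y ∈ klBall L μ 0 then θ * transferBarRelIdx L G P r β U n j' Qm x y else 0) + Ran x y ≤
        θ * transferBarRelIdx L G P r β U n j' Qm x y + Ran x y := fun x y => by linarith [hite x y]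
    have hsplit := kltc_fourTerm_split_le hm (fun a' => hρ0 j a') (fun c => hρ0 j' c)
      (fun x y => (if x ∈ klBall L μ 0 ∧ y ∈ klBall L μ 0 then θ * transferBarRelIdx L G P r β U n j' Qm x y else 0) + Ran x y)
      (fun x y => θ * transferBarRelIdx L G P r β U n j' Qm x y) Ran hSle k k'
    beta_reduce at hsplit
    have hFT1 : θ * transferBarRelIdx L G P r β U n j' Qm k k' +
        ∑ c, θ * transferBarRelIdx L G P r β U n j' Qm k c * ρ j' Qm c * (3 / 2 * mA) +
        ∑ a', 3 / 2 * mA * ρ j Qm a' * (θ * transferBarRelIdx L G P r β U n j' Qm a' k') +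
        ∑ a', ∑ c, 3 / 2 * mA * ρ j Qm a' * (θ * transferBarRelIdx L G P r β U n j' Qm a' c) * ρ j' Qm c * (3 / 2 * mA) ≤
        θ * (transferBarRelIdx L G P r β U n j' Qm k k' + (2 + 1 / 32) * (42 / 10 * (1 / 32) + 2 * (1 / 32)) * (klIdxPrefactor r n * ((P.Klam * U) ^ 2 * ((((2 : ℝ) ^ n)⁻¹ + ((L : ℝ))⁻¹) * klIdxMass n j') +
        ((P.Klam * |U|) ^ 3 * ((2 : ℝ) ^ n)⁻¹ + thermalBar G P U β n) * klIdxMass n j'))) := by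
      rw [hρdef]
      exact klam_inheritedFT_le (M := M) β μ _ hKf hβ hβL hCF hKl hr n j' hj1 h1 hη₀ hm hstep hθ0 Qm Qm Qm k k'
    have hfloor := klam_floor_le_room (L := L) (G := G) hCF hKl hr β U n j' Qm k k'
    have hroom := transferBarRelIdx_succ_room hCF P hKl hr β U h1 Qm k k'
    -- atomize the floor, the room, the bars
    obtain ⟨F, hF⟩ : ∃ F : ℝ, F = (klIdxPrefactor r n * ((P.Klam * U) ^ 2 * ((((2 : ℝ) ^ n)⁻¹ + ((L : ℝ))⁻¹) * klIdxMass n j') +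
        ((P.Klam * |U|) ^ 3 * ((2 : ℝ) ^ n)⁻¹ + thermalBar G P U β n) * klIdxMass n j')) := ⟨_, rfl⟩
    obtain ⟨Rm, hRm⟩ : ∃ Rm : ℝ, Rm = (klIdxPrefactor r (n + 1) * ((P.Klam * U) ^ 2 *
              ((min (klTorusNorm L (k - k') / klScale klE0 (n + 1)) (klScale klE0 (n + 1) / klTorusNorm L (k - k')) +
                  min (klTorusNorm L (k + k' - Qm) / klScale klE0 (n + 1)) (klScale klE0 (n + 1) / klTorusNorm L (k + k' - Qm)) +
                  ((2 : ℝ) ^ n)⁻¹ + 3 * ((L : ℝ))⁻¹) * klIdxMass n j' + ((4 : ℝ) ^ (n + 1))⁻¹ * klIdxOverlap (n + 1) j') +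
            ((P.Klam * |U|) ^ 3 * ((2 : ℝ) ^ n)⁻¹ + 3 * thermalBar G P U β (n + 1)) * klIdxMass n j')) := ⟨_, rfl⟩
    rw [← hF] at hFT1 hfloor
    rw [← hRm] at hfloor hroom hb
    have hF0 : 0 ≤ F := by
      rw [hF]
      have := thermalBar_nonneg' hCF P U β n
      have := klIdxPrefactor_nonneg hr n
      have := klIdxMass_nonneg n j'
      positivity
    have key : θ * ((2 + 1 / 32) * (42 / 10 * (1 / 32) + 2 * (1 / 32)) * F) ≤ θ * (2 / 5 * Rm) :=
      mul_le_mul_of_nonneg_left (by nlinarith) hθ0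
    have key2 := mul_le_mul_of_nonneg_left hroom hθ0
    have key3 : 0 ≤ θ * transferBarRelIdx L G P r β U n j' Qm k k' := mul_nonneg hθ0 (hTb0 k k')
    linarith

end AnalyticResolvedAll

end Summit.HubbardSuperconductivity.HubbardSuperconductivity.Theorems.KLRegimeSplit

end
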